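import Literature.AlgebraicGeometry.Frobenioids.PadicKummerRemark242Functor
import Literature.AlgebraicGeometry.Frobenioids.PadicKummerGaloisChartCoset
import Literature.AlgebraicGeometry.Frobenioids.PadicFrobenioidPrimitiveSplit
import Literature.AnabelianGeometry.SemiGraphs.CosetCategoriesFSM
import HarnessLib

/-!
# Frobenioids II, Remark 2.4.2 at the functor level, over the base `B(G_{ℚ_p})⁰ → D₀` of §2

S. Mochizuki, *The geometry of Frobenioids II: poly-Frobenioids*, Kyushu J. Math. **62** (2008) 401–460,
§2, Remark 2.4.2 p. 22 [cite: MochizukiFrdII2008, Rmk 2.4.2 p.22] ("an example of such a `Ψ` is provided by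
the unit-wise Frobenius functor … which acts on `F_N(Aᵢ)` [relative to the natural isomorphisms
`F_N(Aᵢ) ⥲ ℤ/Nℤ`] by 'raising to the `ζ`-th power'"), in the setting of §2 p. 17 (`D = B^temp(Π, Π°)⁰ → D₀`;
here `Π = G_{ℚ_p}` on abc-iut-w5-d229's small model `CosetCat (G_{ℚ_p})`).

PROOF-ONLY sequel (abc-iut cell, layer L1, seat abc-iut-w5-d248 gen 3; SUBDAG-FrdII-Thm24 row L26, sub-piece
(α-ζ) of GAP row G-L1t7-α) to `PadicKummerRemark242Functor.lean`: the chart-level theorems specialised to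
abc-iut-L1-t7's canonical chart `galoisChartCoset` of an object `A` with `A_D = G_{ℚ_p}/U`, `U` normal (file
D3b), whose kernel property `hker` IS abc-iut-L1-t7's `resAut_eq_one_iff` — so over the base of §2 the only
inputs left are the [FrdI] Prop. 2.9 (ii) existence data of the unit-wise Frobenius functor (inhabited for
absolutely primitive `Φ`, `rmk242_inputs_of_isAbsolutelyPrimitive`) and `ζ` of co-prime type: for EVERY such
object, every open normal `H ⊆ G_{ℚ_p}` and every invariant datum, the automorphism of abc-iut-L1-t7's
`contextOfObject` INDUCED BY `Ψ_ζ` acts on `F_{l^k}(A)` by `ζ(l)` and is `InvariantIncompatible` when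
`ζ(l) ≢ 1 (mod l^k)`. Nothing here concerns [IUTchIII]; no statement of [FrdII] is restated.
-/

noncomputable section

namespace Literature.AlgebraicGeometry.Frobenioids

namespace PadicFrd.Datum.GaloisChart

open CategoryTheory Opposite Function Field IntermediateField Kummer
open Literature.NumberTheory.GaloisRepresentations Literature.AnabelianGeometry.SemiGraphs QuasiTemperoid
open PreFrobenioid PreFrobenioid.UnitWiseFrobeniusZeta PadicKummer PadicKummer.Def22Context

variable {p : ℕ} [Fact p.Prime] {d : Datum (CosetCat (GalFbar ℚ_[p])) p} (hd : d.base = galoisCosetBase p)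
  (hF : IsFrobenioid d.structureFunctor) (τ : CharacteristicSplitting d.structureFunctor)
  (hnorm : IsOfType (IsFrobeniusNormalized d.structureFunctor))
  (hbt : IsOfType (IsBaseTrivial d.structureFunctor)) (histr : IsOfIsotropicType d.structureFunctor)
  (hup : IsOfUnitProfiniteType d.structureFunctor)
  {P : Presection d.frobenioid} {Fr : ℕ+ →* End P.ι} (hpair : IsBaseFrobeniusPair d.structureFunctor P Fr)
  (ζ : Nat.Primes → ℕ+) (hζ : IsOfCoprimeType ζ)
  {A : d.frobenioid} (hA : A.base.sg.toSubgroup.Normal)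
  (H : Subgroup (absoluteGaloisGroup ℚ_[p])) [H.Normal] (hH : IsOpen (H : Set (absoluteGaloisGroup ℚ_[p])))

/-- **Remark 2.4.2 over the base of §2 — "acts on `F_N(A)` … by raising to the `ζ`-th power"**: for an object
`A` with `A_D = G_{ℚ_p}/U` Galois, the automorphism of abc-iut-L1-t7's `contextOfObject` induced by the unit-wise
Frobenius functor `Ψ_ζ` (through the canonical chart `galoisChartCoset`, `hker := resAut_eq_one_iff`, over the
identity of `G_{ℚ_p}`) acts on `F_{l^k}(A)` by `ζ(l)` relative to every invariant datum.
[cite: MochizukiFrdII2008, Rmk 2.4.2 p.22] -/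
theorem actsOnFNByPower_unitWiseFrobenius_coset {N : ℕ} (l : Nat.Primes) (k : ℕ) (hN : N = (l : ℕ) ^ k)
    (inv : FNInvariant (contextOfObject d hd A hA H hH) N) :
    haveI := full_psiStrict hF τ hnorm hbt histr hup hpair ζ hζ
    haveI := faithful_psiStrict hF τ hnorm hbt histr hup hpair ζ hζ
    haveI := finiteDimensional_objField d A
    haveI := normal_objField d A hA
    ActsOnFNByPower (contextOfObject d hd A hA H hH) (contextOfObject d hd A hA H hH) N
      ((isoOfFunctor (psiStrict hF τ hnorm hbt histr hup hpair ζ) (galoisChartCoset d hd A) (galoisChartCoset d hd A)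
        (hO_psiStrict hF τ hnorm hbt histr hup hpair ζ) (resAut_eq_one_iff d A) (resAut_eq_one_iff d A) H hH H hH
        (ContinuousMulEquiv.refl _)
        (houter_psiStrict hF τ hnorm hbt histr hup hpair ζ hζ (galoisChartCoset d hd A) (resAut_eq_one_iff d A))
        (map_H_refl H) Iff.rfl).thm24Data N)
      inv inv (((ζ l : ℕ+) : ℕ) : ZMod N) := by
  haveI := finiteDimensional_objField d A
  haveI := normal_objField d A hA
  subst hN
  exact actsOnFNByPower_unitWiseFrobenius hF τ hnorm hbt histr hup hpair ζ hζ (galoisChartCoset d hd A)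
    (resAut_eq_one_iff d A) H hH l k inv

/-- **Remark 2.4.2 over the base of §2 — the incompatibility**: with `ζ(l) ≢ 1 (mod l^k)` the isomorphism
`F_{l^k}(A) ⥲ F_{l^k}(A)` induced by `Ψ_ζ` on abc-iut-L1-t7's `contextOfObject` is NOT compatible with the
natural isomorphisms `F_{l^k}(A) ⥲ ℤ/l^kℤ`, for every invariant datum.
[cite: MochizukiFrdII2008, Rmk 2.4.2 p.22] -/
theorem invariantIncompatible_unitWiseFrobenius_coset {N : ℕ} (l : Nat.Primes) (k : ℕ) (hN : N = (l : ℕ) ^ k)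
    (hζl : (((ζ l : ℕ+) : ℕ) : ZMod N) ≠ 1) (inv : FNInvariant (contextOfObject d hd A hA H hH) N) :
    haveI := full_psiStrict hF τ hnorm hbt histr hup hpair ζ hζ
    haveI := faithful_psiStrict hF τ hnorm hbt histr hup hpair ζ hζ
    haveI := finiteDimensional_objField d A
    haveI := normal_objField d A hA
    InvariantIncompatible (contextOfObject d hd A hA H hH) (contextOfObject d hd A hA H hH) N
      ((isoOfFunctor (psiStrict hF τ hnorm hbt histr hup hpair ζ) (galoisChartCoset d hd A) (galoisChartCoset d hd A)
        (hO_psiStrict hF τ hnorm hbt histr hup hpair ζ) (resAut_eq_one_iff d A) (resAut_eq_one_iff d A) H hH H hH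
        (ContinuousMulEquiv.refl _)
        (houter_psiStrict hF τ hnorm hbt histr hup hpair ζ hζ (galoisChartCoset d hd A) (resAut_eq_one_iff d A))
        (map_H_refl H) Iff.rfl).thm24Data N)
      inv inv := by
  haveI := finiteDimensional_objField d A
  haveI := normal_objField d A hA
  subst hN
  exact invariantIncompatible_unitWiseFrobenius hF τ hnorm hbt histr hup hpair ζ hζ (galoisChartCoset d hd A)
    (resAut_eq_one_iff d A) H hH l k hζl inv

/-- **Theorem 2.4 (i) HOLDS for `Ψ_ζ` over the base of §2** (for `μ_N(ℚ̄_p) ⊆ K_A`, `A` `(N, H)`-saturated, any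
normalisation): abc-iut-L1-t7's `thm24i_ofObjects` for the context automorphism induced by `Ψ_ζ`
(`hfs := Iff.rfl`). [cite: MochizukiFrdII2008, Thm 2.4 (i) p.19] -/
theorem thm24i_unitWiseFrobenius_coset (N : ℕ) [NeZero N]
    (hμ : ∀ ξ : rootsOfUnity N (AlgebraicClosure ℚ_[p]),
      ((ξ : (AlgebraicClosure ℚ_[p])ˣ) : AlgebraicClosure ℚ_[p]) ∈ objField d A)
    (fs : Prop) (eFN : FN (contextOfObject d hd A hA H hH) N ≃+ ZMod N)
    (hc : IsNHSaturated (contextOfObject d hd A hA H hH) N) :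
    haveI := full_psiStrict hF τ hnorm hbt histr hup hpair ζ hζ
    haveI := faithful_psiStrict hF τ hnorm hbt histr hup hpair ζ hζ
    haveI := finiteDimensional_objField d A
    haveI := normal_objField d A hA
    haveI := locallyCompactSpace_H_contextOfObject d hd A hA H hH
    letI := (galoisChartCoset d hd A).galAction
    Thm24i (contextOfObject d hd A hA H hH) (contextOfObject d hd A hA H hH) N p p fs fs
      ((isoOfFunctor (psiStrict hF τ hnorm hbt histr hup hpair ζ) (galoisChartCoset d hd A) (galoisChartCoset d hd A)
        (hO_psiStrict hF τ hnorm hbt histr hup hpair ζ) (resAut_eq_one_iff d A) (resAut_eq_one_iff d A) H hH H hH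
        (ContinuousMulEquiv.refl _)
        (houter_psiStrict hF τ hnorm hbt histr hup hpair ζ hζ (galoisChartCoset d hd A) (resAut_eq_one_iff d A))
        (map_H_refl H) Iff.rfl).thm24Data N)
      ((contextOfObject d hd A hA H hH).dualityIsoOfLocalDuality N eFN hc
        (cupDualH_bijective_ofGalois_mlf p (objField d A) H hH (galoisChartCoset d hd A).res
          (galoisChartCoset d hd A).res_smul ((galoisChartCoset d hd A).muModel N hμ)))
      ((contextOfObject d hd A hA H hH).dualityIsoOfLocalDuality N
        (((isoOfFunctor (psiStrict hF τ hnorm hbt histr hup hpair ζ) (galoisChartCoset d hd A)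
          (galoisChartCoset d hd A) (hO_psiStrict hF τ hnorm hbt histr hup hpair ζ) (resAut_eq_one_iff d A)
          (resAut_eq_one_iff d A) H hH H hH (ContinuousMulEquiv.refl _)
          (houter_psiStrict hF τ hnorm hbt histr hup hpair ζ hζ (galoisChartCoset d hd A) (resAut_eq_one_iff d A))
          (map_H_refl H) Iff.rfl).isoFN N).symm.trans eFN)
        (((isoOfFunctor (psiStrict hF τ hnorm hbt histr hup hpair ζ) (galoisChartCoset d hd A)
          (galoisChartCoset d hd A) (hO_psiStrict hF τ hnorm hbt histr hup hpair ζ) (resAut_eq_one_iff d A)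
          (resAut_eq_one_iff d A) H hH H hH (ContinuousMulEquiv.refl _)
          (houter_psiStrict hF τ hnorm hbt histr hup hpair ζ hζ (galoisChartCoset d hd A) (resAut_eq_one_iff d A))
          (map_H_refl H) Iff.rfl).isNHSaturated_iff N).mp hc)
        (cupDualH_bijective_ofGalois_mlf p (objField d A) H hH (galoisChartCoset d hd A).res
          (galoisChartCoset d hd A).res_smul ((galoisChartCoset d hd A).muModel N hμ))) :=
  haveI := full_psiStrict hF τ hnorm hbt histr hup hpair ζ hζ
  haveI := faithful_psiStrict hF τ hnorm hbt histr hup hpair ζ hζ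
  haveI := finiteDimensional_objField d A
  haveI := normal_objField d A hA
  haveI := locallyCompactSpace_H_contextOfObject d hd A hA H hH
  thm24i_ofObjects hd hA hd hA _ N hμ hμ fs fs Iff.rfl eFN hc

/-! ### Non-vacuity: the absolutely primitive `p`-adic Frobenioid `C^⊢` over the base of §2 -/

/-- **Remark 2.4.2 with every input discharged**: for the absolutely primitive `p`-adic Frobenioid `C^⊢`
(abc-iut-L1-t4's `Datum.prim`) over the base `B(G_{ℚ_p})⁰ → D₀` of §2, EVERY object `A` with `A_D` Galois, every
open normal `H ⊆ G_{ℚ_p}`, every odd prime `l` and every invariant datum `inv` on `F_l(A)`: the unit-wise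
Frobenius functor `Ψ_ζ` for some `ζ` of co-prime type — built from Remark 1.2.1's data (the characteristic
splitting `τ_p`, a base-Frobenius pair) — is a self-equivalence of `C^⊢` lying over `C^⊢ → F_Φ` on the nose whose
induced automorphism of abc-iut-L1-t7's `contextOfObject` is `InvariantIncompatible` with `inv`.
[cite: MochizukiFrdII2008, Rmk 2.4.2 p.22] -/
theorem rmk242_unitWiseFrobenius_prim (p : ℕ) [Fact p.Prime] :
    let d₀ : Datum (CosetCat (GalFbar ℚ_[p])) p := Datum.prim (galoisCosetBase p) (isPadicLocal_galoisCosetBase p)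
      CosetCat.isConnected CosetCat.isTotallyEpimorphic
    ∀ {A : d₀.frobenioid} (hA : A.base.sg.toSubgroup.Normal) (H : Subgroup (absoluteGaloisGroup ℚ_[p]))
      [H.Normal] (hH : IsOpen (H : Set (absoluteGaloisGroup ℚ_[p]))) (l : Nat.Primes), (l : ℕ) ≠ 2 →
      ∀ inv : FNInvariant (contextOfObject d₀ rfl A hA H hH) l,
      ∃ (hF : IsFrobenioid d₀.structureFunctor) (τ : CharacteristicSplitting d₀.structureFunctor)
        (hbt : IsOfType (IsBaseTrivial d₀.structureFunctor)) (hup : IsOfUnitProfiniteType d₀.structureFunctor)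
        (P : Presection d₀.frobenioid) (Fr : ℕ+ →* End P.ι) (hpair : IsBaseFrobeniusPair d₀.structureFunctor P Fr)
        (ζ : Nat.Primes → ℕ+) (hζ : IsOfCoprimeType ζ),
        (psiStrict hF τ ModelFrobenioid.isOfType_isFrobeniusNormalized hbt d₀.thm12_isOfIsotropicType hup hpair
            ζ).IsEquivalence ∧
        psiStrict hF τ ModelFrobenioid.isOfType_isFrobeniusNormalized hbt d₀.thm12_isOfIsotropicType hup hpair ζ ⋙
            d₀.structureFunctor = d₀.structureFunctor ∧
        haveI := full_psiStrict hF τ ModelFrobenioid.isOfType_isFrobeniusNormalized hbt d₀.thm12_isOfIsotropicType hup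
          hpair ζ hζ
        haveI := faithful_psiStrict hF τ ModelFrobenioid.isOfType_isFrobeniusNormalized hbt d₀.thm12_isOfIsotropicType
          hup hpair ζ hζ
        haveI := finiteDimensional_objField d₀ A
        haveI := normal_objField d₀ A hA
        InvariantIncompatible (contextOfObject d₀ rfl A hA H hH) (contextOfObject d₀ rfl A hA H hH) l
          ((isoOfFunctor
            (psiStrict hF τ ModelFrobenioid.isOfType_isFrobeniusNormalized hbt d₀.thm12_isOfIsotropicType hup hpair ζ)
            (galoisChartCoset d₀ rfl A) (galoisChartCoset d₀ rfl A)
            (hO_psiStrict hF τ ModelFrobenioid.isOfType_isFrobeniusNormalized hbt d₀.thm12_isOfIsotropicType hup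
              hpair ζ)
            (resAut_eq_one_iff d₀ A) (resAut_eq_one_iff d₀ A) H hH H hH (ContinuousMulEquiv.refl _)
            (houter_psiStrict hF τ ModelFrobenioid.isOfType_isFrobeniusNormalized hbt d₀.thm12_isOfIsotropicType hup
              hpair ζ hζ (galoisChartCoset d₀ rfl A) (resAut_eq_one_iff d₀ A))
            (map_H_refl H) Iff.rfl).thm24Data l)
          inv inv := by
  intro d₀ A hA H _ hH l hl inv
  obtain ⟨τ, P, Fr, ζ, hF, -, hbt, -, hup, hpair, hζ, hne⟩ :=
    rmk242_inputs_of_isAbsolutelyPrimitive d₀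
      (prim_isMonoidData (galoisCosetBase p) (isPadicLocal_galoisCosetBase p) CosetCat.isConnected
        CosetCat.isTotallyEpimorphic CosetCat.isOfFSMType)
      (Datum.prim_isAbsolutelyPrimitive (galoisCosetBase p) (isPadicLocal_galoisCosetBase p) CosetCat.isConnected
        CosetCat.isTotallyEpimorphic)
  refine ⟨hF, τ, hbt, hup, P, Fr, hpair, ζ, hζ,
    psiStrict_isEquivalence hF τ _ hbt _ hup hpair ζ hζ, psiStrict_comp hF τ _ hbt _ hup hpair ζ, ?_⟩
  have h1 : (l : ℕ) = (l : ℕ) ^ 1 := (pow_one _).symm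
  exact invariantIncompatible_unitWiseFrobenius_coset rfl hF τ _ hbt _ hup hpair ζ hζ hA H hH l 1 h1
    (by rw [h1]; exact hne l hl) inv

end PadicFrd.Datum.GaloisChart

end Literature.AlgebraicGeometry.Frobenioids

end
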